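import Summits.Ventures.DiscreteObjects.Hadamard.OrderDvd167
import Summits.Ventures.DiscreteObjects.Hadamard.NegacyclicObstruction

/-!
# Hadamard 668 census, family F12 — NO automorphism of order 668; 167 ∣ |g| ⇒ |g| ∈ {167, 334} (kernel)

Framing: lottery ticket; floor = certified bounds/negative ranges.

Cell pub-namedobj (venture DiscreteObjects), target (H), hadamard gen 12.  `Order334Nega` showed that a signed automorphism of a
Hadamard matrix of order `668` whose permutation pair has order `668` makes `H` equivalent to a NEGACYCLIC `±1` matrix of order
`668` (single `668`-cycles on rows and columns, cycle sign products `−1`); `NegacyclicObstruction` shows that no negacyclic `±1`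
matrix `N` of order `n ≡ 4 (mod 8)` has `N Nᵀ = n I`.  Hence:
* `no_signedAut_regular_nega` (general): a Hadamard matrix of order `n ≡ 4 (mod 8)` has no signed automorphism acting on rows and on
  columns as single `n`-cycles with cycle sign products `−1` (the re-signed orbit array `x(k,m) = (∏_{l<k} d)(∏_{l<m} e) H(π^k i₀, κ^m j₀)`
  is shift-invariant, `n`-antiperiodic and has orthogonal rows);
* **`no_hadamard668_signedAut_order668`**, **`hadamard668_signedAut_orderOf_ne_668`**: no Hadamard matrix of order `668` has a
  signed automorphism whose permutation pair has order `668` — a genuine EXCLUSION on the even side of the order table;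
* **`hadamard668_signedAut_orderOf_of_167_dvd'`**: `167 ∣ orderOf (π, κ) ⇒ orderOf (π, κ) ∈ {167, 334}` (with gen 5's
  `hadamard668_fixedRows_167` and `hadamard668_signedAut_orderOf_334`: four-circulant shape, or two-negacirculant shape).
So the largest cyclic symmetry an H(668) can have in the `167`-direction is the Williamson/Ito-type order `334`.
Ours, not literature; no `sorry`.
-/

namespace Summit.Ventures.DiscreteObjects.Hadamard

open Finset BigOperators Matrix

open Literature.Combinatorics.Designs.GoethalsSeidel (IsHadamardMatrix)

variable {ι : Type*} [Fintype ι] [DecidableEq ι]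

variable {H : Matrix ι ι ℤ} {π κ : Equiv.Perm ι} {d e : ι → ℤ}

/-- **No regular nega-cyclic automorphism in order `n ≡ 4 (mod 8)`.**  If `π`, `κ` are single `n`-cycles (`n = |ι|`, no fixed
point of `π^k`, `κ^k` for `0 < k < n`, `κ^n = 1`) and the column cycle sign product is `−1`, contradiction. -/
theorem no_signedAut_regular_nega (hH : IsHadamardMatrix H) (hn : Fintype.card ι % 8 = 4) (haut : IsSignedAut H π κ d e)
    (hκN : κ ^ Fintype.card ι = 1)
    (hfr : ∀ i k, 0 < k → k < Fintype.card ι → (π ^ k) i ≠ i)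
    (hfc : ∀ j k, 0 < k → k < Fintype.card ι → (κ ^ k) j ≠ j)
    (hE : ∀ j, cyc κ e j (Fintype.card ι) = -1) : False := by
  set n := Fintype.card ι with hndef
  have hd := haut.1
  have he := haut.2.1
  have hA := haut.2.2
  obtain ⟨i₀⟩ : Nonempty ι := by rw [← Fintype.card_pos_iff]; omega
  set j₀ := i₀ with hj₀def
  -- the single column orbit
  have hO : orbFin κ n j₀ = univ :=
    Finset.eq_univ_of_card _ (by rw [card_orbFin_of_free (hfc j₀)])
  set x : ℕ → ℕ → ℤ := fun k m => cyc π d i₀ k * cyc κ e j₀ m * H ((π ^ k) i₀) ((κ ^ m) j₀) with hxdef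
  have hx : ∀ k m, x k m = 1 ∨ x k m = -1 := by
    intro k m
    rcases cyc_pm π d hd i₀ k with h1 | h1 <;> rcases cyc_pm κ e he j₀ m with h2 | h2 <;>
      rcases hH.1 ((π ^ k) i₀) ((κ ^ m) j₀) with h3 | h3 <;> simp [hxdef, h1, h2, h3]
  have hshift : ∀ k m, x (k + 1) (m + 1) = x k m := by
    intro k m
    simp only [hxdef]
    rw [cyc_succ', cyc_succ', pow_succ', pow_succ', Equiv.Perm.mul_apply, Equiv.Perm.mul_apply, hA]
    have h1 := pm_mul_self (hd ((π ^ k) i₀))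
    have h2 := pm_mul_self (he ((κ ^ m) j₀))
    calc cyc π d i₀ k * d ((π ^ k) i₀) * (cyc κ e j₀ m * e ((κ ^ m) j₀)) *
          (d ((π ^ k) i₀) * e ((κ ^ m) j₀) * H ((π ^ k) i₀) ((κ ^ m) j₀))
        = (d ((π ^ k) i₀) * d ((π ^ k) i₀)) * (e ((κ ^ m) j₀) * e ((κ ^ m) j₀)) *
          (cyc π d i₀ k * cyc κ e j₀ m * H ((π ^ k) i₀) ((κ ^ m) j₀)) := by ring
      _ = cyc π d i₀ k * cyc κ e j₀ m * H ((π ^ k) i₀) ((κ ^ m) j₀) := by rw [h1, h2, one_mul, one_mul]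
  have ham : ∀ k m, x k (m + n) = -x k m := by
    intro k m
    simp only [hxdef]
    rw [cyc_add, hE, pow_add, hκN, mul_one]
    ring
  have horth : ∀ k, 0 < k → k < n → ∑ m ∈ range n, x 0 m * x k m = 0 := by
    intro k hk0 hk
    have hrow := hadamard_row_orth H hH (Ne.symm (hfr i₀ k hk0 hk))
    rw [← hO, sum_orbFin_of_free (hfc j₀)] at hrow
    have e1 : ∀ m, x 0 m * x k m = cyc π d i₀ k * (H i₀ ((κ ^ m) j₀) * H ((π ^ k) i₀) ((κ ^ m) j₀)) := by
      intro m
      simp only [hxdef]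
      have h0 : cyc π d i₀ 0 = 1 := by simp [cyc]
      have h2 := pm_mul_self (cyc_pm κ e he j₀ m)
      rw [h0, pow_zero, Equiv.Perm.one_apply]
      calc 1 * cyc κ e j₀ m * H i₀ ((κ ^ m) j₀) * (cyc π d i₀ k * cyc κ e j₀ m * H ((π ^ k) i₀) ((κ ^ m) j₀))
          = (cyc κ e j₀ m * cyc κ e j₀ m) * (cyc π d i₀ k * (H i₀ ((κ ^ m) j₀) * H ((π ^ k) i₀) ((κ ^ m) j₀))) := by ring
        _ = _ := by rw [h2, one_mul]
    rw [Finset.sum_congr rfl fun m _ => e1 m, ← Finset.mul_sum, hrow, mul_zero]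
  exact no_negacyclic_array n hn x hx hshift ham horth

/-- **No Hadamard matrix of order 668 has a signed automorphism whose permutation pair has order 668** (`π^668 = κ^668 = 1`,
`(π⁴, κ⁴) ≠ (1,1)`, `(π^334, κ^334) ≠ (1,1)` is impossible). -/
theorem no_hadamard668_signedAut_order668 (hH : IsHadamardMatrix H) (hι : Fintype.card ι = 668) (haut : IsSignedAut H π κ d e)
    (hπ : π ^ 668 = 1) (hκ : κ ^ 668 = 1) (h4 : π ^ 4 ≠ 1 ∨ κ ^ 4 ≠ 1) (h334 : π ^ 334 ≠ 1 ∨ κ ^ 334 ≠ 1) : False := by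
  obtain ⟨-, -, hE⟩ := hadamard668_order668_nega hH hι haut hπ hκ h4 h334
  obtain ⟨hfr, hfc⟩ := hadamard668_order668_cycle hH hι haut hπ hκ h4 h334
  exact no_signedAut_regular_nega hH (by rw [hι]) haut (by rw [hι]; exact hκ)
    (by rw [hι]; exact hfr) (by rw [hι]; exact hfc) (by rw [hι]; exact hE)

/-- **Order form: the permutation pair of a signed automorphism of a Hadamard matrix of order 668 never has order 668.** -/
theorem hadamard668_signedAut_orderOf_ne_668 (hH : IsHadamardMatrix H) (hι : Fintype.card ι = 668)
    (π κ : Equiv.Perm ι) (d e : ι → ℤ) (haut : IsSignedAut H π κ d e) :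
    orderOf ((π, κ) : Equiv.Perm ι × Equiv.Perm ι) ≠ 668 := by
  intro hord
  obtain ⟨hπ, hκ, h4⟩ := pow_data_of_orderOf hord (a := 4) (by norm_num) (by norm_num)
  obtain ⟨-, -, h334⟩ := pow_data_of_orderOf hord (a := 334) (by norm_num) (by norm_num)
  exact no_hadamard668_signedAut_order668 hH hι haut hπ hκ h4 h334

/-- **The `167`-column, final form: `167 ∣ orderOf (π, κ) ⇒ orderOf (π, κ) ∈ {167, 334}`.** -/
theorem hadamard668_signedAut_orderOf_of_167_dvd' (hH : IsHadamardMatrix H) (hι : Fintype.card ι = 668)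
    (π κ : Equiv.Perm ι) (d e : ι → ℤ) (haut : IsSignedAut H π κ d e)
    (h167 : 167 ∣ orderOf ((π, κ) : Equiv.Perm ι × Equiv.Perm ι)) :
    orderOf ((π, κ) : Equiv.Perm ι × Equiv.Perm ι) = 167 ∨ orderOf ((π, κ) : Equiv.Perm ι × Equiv.Perm ι) = 334 := by
  rcases hadamard668_signedAut_orderOf_of_167_dvd hH hι π κ d e haut h167 with h | h | h
  · exact Or.inl h
  · exact Or.inr h
  · exact (hadamard668_signedAut_orderOf_ne_668 hH hι π κ d e haut h).elim

end Summit.Ventures.DiscreteObjects.Hadamard
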